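import Summits.QuantumFields.GaugeBoot.DiagonalRPTorusPlaquetteSwap
import Summits.Ventures.YMGap.RobustBall.RectangleCode
import HarnessLib

/-!
# Transverse squares and the rings around them on `(ℤ/L)^d` (gauge-boot, L3 sequel, 4/7)

HONEST FRAMING (cell `pub-gaugeboot`, page 1 of every file): the venture produces certified bounds
on lattice expectations at stated coupling, gauge group, dimension and torus size; NOT a mass gap,
NOT a continuum limit, NOT a string tension; NOT Yang–Mills-summit-bearing (barriers
`FixedCouplingUltralocality`, `PerturbativeInvisibility`). This module is bookkeeping for a
structural NEGATIVE result (`DiagonalRPTorusInnerHalfNegativeHighDim`); it discharges nothing by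
itself.

## Content (torus `(ℤ/L)^d`, `L ≥ 3`, directions `m < k < l`)

`sq k l x` (the transverse square `(x; k, l)`), `eStart`/`eDir`/`eEnd` (its edges, `link_sq`),
`dn x m = x - e_m`, `ring m x a` (the face `(eStart x a; m, eDir a)` between the squares at `x`
and `x + e_m`, `hasLink_ring_iff`), `hasLink_iff'` (the plaquettes through a link), and the
distinctness facts the cover argument of `DiagonalRPTorusTubeCover` uses.

Elementary bookkeeping; no named fact.
-/

open Finset Function

namespace Summit.QuantumFields.GaugeBoot

open Literature.MathematicalPhysics.QuantumFieldTheory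

namespace DiagRPTube

variable {d L : ℕ}

open Summit.Ventures.YMGap.RobustBall (one_ne_zero_of_three_le two_ne_zero_of_three_le)

/-! ## Sites: shifting down -/

section Sites

/-- `x - e_m`. -/
def dn (x : Site d L) (m : Fin d) : Site d L := x - Pi.single m 1

/-- `(x - e_m) + e_m = x`. -/
@[simp] theorem dn_shift (x : Site d L) (m : Fin d) : (dn x m).shift m = x := by
  simp [dn, Site.shift]

/-- `(x + e_m) - e_m = x`. -/
@[simp] theorem shift_dn (x : Site d L) (m : Fin d) : dn (x.shift m) m = x := by
  simp [dn, Site.shift]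

/-- Shifting down commutes with shifting. -/
theorem dn_shift_comm (x : Site d L) (m n : Fin d) : (dn x m).shift n = dn (x.shift n) m := by
  simp only [dn, Site.shift]; abel

/-- `y + e_m = s ↔ y = s - e_m`. -/
theorem shift_eq_iff_eq_dn {y s : Site d L} {m : Fin d} : y.shift m = s ↔ y = dn s m := by
  constructor
  · rintro rfl; exact (shift_dn y m).symm
  · rintro rfl; exact dn_shift s m

/-- `x + e_m ≠ x` (`L ≥ 3`). -/
theorem shift_ne (hL : 3 ≤ L) (x : Site d L) (m : Fin d) : x.shift m ≠ x := by
  intro h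
  have h2 := congrFun h m
  simp only [Site.shift, Pi.add_apply, Pi.single_eq_same, add_eq_left] at h2
  exact one_ne_zero_of_three_le hL h2

/-- `x + e_m + e_m ≠ x` (`L ≥ 3`). -/
theorem shift_shift_ne (hL : 3 ≤ L) (x : Site d L) (m : Fin d) : (x.shift m).shift m ≠ x := by
  intro h
  have h2 := congrFun h m
  simp only [Site.shift, Pi.add_apply, Pi.single_eq_same, add_assoc, add_eq_left, one_add_one_eq_two] at h2
  exact two_ne_zero_of_three_le hL h2

/-- `x + e_m = x + e_n → m = n` (`L ≥ 3`). -/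
theorem shift_injective_dir (hL : 3 ≤ L) (x : Site d L) {m n : Fin d} (h : x.shift m = x.shift n) :
    m = n := by
  by_contra hmn
  have h2 := congrFun h m
  simp only [Site.shift, Pi.add_apply, Pi.single_eq_same, Pi.single_eq_of_ne hmn, add_zero,
    add_eq_left] at h2
  exact one_ne_zero_of_three_le hL h2

/-- `x + e_m + e_n ≠ x` for `m ≠ n` (`L ≥ 3`). -/
theorem shift_shift_ne' (hL : 3 ≤ L) (x : Site d L) {m n : Fin d} (hmn : m ≠ n) :
    (x.shift m).shift n ≠ x := by
  intro h
  have h2 := congrFun h m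
  simp only [Site.shift, Pi.add_apply, Pi.single_eq_same, Pi.single_eq_of_ne hmn, add_zero,
    add_eq_left] at h2
  exact one_ne_zero_of_three_le hL h2

end Sites

/-! ## Which plaquettes contain a given link -/

section HasLinkIff

/-- The links of `(y; a, b)`: `(y,a)`, `(y+e_a,b)`, `(y+e_b,a)`, `(y,b)`. -/
theorem hasLink_iff (q : Plaquette d L) (e : Edge d L) :
    HasLink q e ↔ e = (q.1, q.2.1.1) ∨ e = (q.1.shift q.2.1.1, q.2.1.2) ∨
      e = (q.1.shift q.2.1.2, q.2.1.1) ∨ e = (q.1, q.2.1.2) := by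
  simp only [HasLink, Fin.exists_fin_succ, Fin.exists_fin_zero, or_false, eq_comm]
  rfl

/-- **The plaquettes through the link `(s, m)`**: `(y; a, b)` contains `(s, m)` iff
(`a = m` and `y ∈ {s, s - e_b}`) or (`b = m` and `y ∈ {s, s - e_a}`). -/
theorem hasLink_iff' (q : Plaquette d L) (s : Site d L) (m : Fin d) :
    HasLink q (s, m) ↔ (q.2.1.1 = m ∧ (q.1 = s ∨ q.1 = dn s q.2.1.2)) ∨
      (q.2.1.2 = m ∧ (q.1 = s ∨ q.1 = dn s q.2.1.1)) := by
  rw [hasLink_iff]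
  simp only [Prod.ext_iff, ← shift_eq_iff_eq_dn]
  tauto

end HasLinkIff

/-! ## The transverse square and its edges -/

section Square

variable (k l : Fin d)

/-- The transverse unit square `(x; k, l)`. -/
def sq (hkl : k < l) (x : Site d L) : Plaquette d L := (x, ⟨(k, l), hkl⟩)

/-- Start point of edge `a` of the square at `x`: `x`, `x+e_k`, `x+e_l`, `x`. -/
def eStart (x : Site d L) : Fin 4 → Site d L
  | 0 => x
  | 1 => x.shift k
  | 2 => x.shift l
  | 3 => x

/-- Direction of edge `a`: `k`, `l`, `k`, `l`. -/
def eDir : Fin 4 → Fin d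
  | 0 => k
  | 1 => l
  | 2 => k
  | 3 => l

/-- End point of edge `a`: `eStart a + e_{eDir a}`. -/
def eEnd (x : Site d L) (a : Fin 4) : Site d L := (eStart k l x a).shift (eDir k l a)

variable {k l}

/-- The links of the square are `(eStart a, eDir a)`. -/
theorem link_sq (hkl : k < l) (x : Site d L) (a : Fin 4) : link (sq k l hkl x) a = (eStart k l x a, eDir k l a) := by
  fin_cases a <;> rfl

/-- `eDir a ∈ {k, l}`. -/
theorem eDir_eq_or (a : Fin 4) : eDir k l a = k ∨ eDir k l a = l := by
  fin_cases a <;> simp [eDir]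

/-- Start points of shifted squares are shifted start points. -/
theorem eStart_shift (x : Site d L) (m : Fin d) (a : Fin 4) :
    eStart k l (x.shift m) a = (eStart k l x a).shift m := by
  fin_cases a <;> simp [eStart, WilsonRP.shift_comm]

/-- Start points of down-shifted squares are down-shifted start points. -/
theorem eStart_dn (x : Site d L) (m : Fin d) (a : Fin 4) :
    eStart k l (dn x m) a = dn (eStart k l x a) m := by
  fin_cases a <;> simp [eStart, dn_shift_comm]

/-- End points of shifted squares are shifted end points. -/
theorem eEnd_shift (x : Site d L) (m : Fin d) (a : Fin 4) :
    eEnd k l (x.shift m) a = (eEnd k l x a).shift m := by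
  simp only [eEnd, eStart_shift, WilsonRP.shift_comm]

/-- The square is determined by its base point. -/
theorem sq_injective (hkl : k < l) : Function.Injective (sq (L := L) k l hkl) := fun _ _ h =>
  congrArg Prod.fst h

/-- **The four links of a plaquette are pairwise distinct** (`L ≥ 3`). -/
theorem link_injective (hL : 3 ≤ L) (q : Plaquette d L) : Function.Injective (link q) := by
  have hmn : q.2.1.1 ≠ q.2.1.2 := ne_of_lt q.2.2
  intro a b hab
  fin_cases a <;> fin_cases b
  all_goals first
    | rfl
    | (exfalso; simp only [link] at hab
       first
        | exact hmn (congrArg Prod.snd hab)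
        | exact hmn (congrArg Prod.snd hab).symm
        | exact shift_ne hL q.1 _ (congrArg Prod.fst hab).symm
        | exact shift_ne hL q.1 _ (congrArg Prod.fst hab))

/-- **Distinct edges of the square are distinct links** (`L ≥ 3`). -/
theorem link_sq_injective (hkl : k < l) (hL : 3 ≤ L) (x : Site d L) :
    Function.Injective (link (sq k l hkl x)) :=
  link_injective hL _

/-- **The same edge of two squares**: `link (sq x) a = link (sq y) a → x = y`. -/
theorem eq_of_link_sq_eq (hkl : k < l) (x y : Site d L) (a : Fin 4)
    (h : link (sq k l hkl x) a = link (sq k l hkl y) a) :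
    x = y := by
  rw [link_sq, link_sq] at h
  have h1 := congrArg Prod.fst h
  fin_cases a
  · exact h1
  · simpa [eStart, Site.shift] using h1
  · simpa [eStart, Site.shift] using h1
  · exact h1

/-- The four corners `x`, `x+e_k`, `x+e_l`, `x+e_k+e_l` are pairwise distinct (`L ≥ 3`):
here as the list of inequalities between start/end points that the cover argument uses. -/
theorem corner_nes (hkl : k < l) (hL : 3 ≤ L) (x : Site d L) :
    eStart k l x 0 ≠ eStart k l x 1 ∧ eStart k l x 0 ≠ eStart k l x 2 ∧
      eStart k l x 0 ≠ eEnd k l x 1 ∧ eStart k l x 1 ≠ eStart k l x 2 ∧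
      eStart k l x 1 ≠ eEnd k l x 1 ∧ eStart k l x 2 ≠ eEnd k l x 1 := by
  have hkl' : k ≠ l := ne_of_lt hkl
  simp only [eStart, eEnd, eDir]
  refine ⟨(shift_ne hL x k).symm, (shift_ne hL x l).symm, (shift_shift_ne' hL x hkl').symm,
    fun h => hkl' (shift_injective_dir hL x h), (shift_ne hL _ l).symm, ?_⟩
  rw [WilsonRP.shift_comm]
  exact (shift_ne hL _ k).symm

end Square

/-! ## Rings -/

section Ring

variable {m k l : Fin d}

/-- `m < eDir a`. -/
theorem lt_eDir (hmk : m < k) (hml : m < l) (a : Fin 4) : m < eDir k l a := by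
  rcases eDir_eq_or (k := k) (l := l) a with h | h
  · rw [h]; exact hmk
  · rw [h]; exact hml

/-- **The ring face** through edge `a` between the squares at `x` and at `x + e_m`:
the plaquette `(eStart x a; m, eDir a)`. -/
def ring (hmk : m < k) (hml : m < l) (x : Site d L) (a : Fin 4) : Plaquette d L :=
  (eStart k l x a, ⟨(m, eDir k l a), lt_eDir hmk hml a⟩)

variable (hmk : m < k) (hml : m < l) (hkl : k < l)
include hmk hml hkl

/-- **The links of a ring face**: `(eStart a, m)`, edge `a` of the square at `x + e_m`,
`(eEnd a, m)`, edge `a` of the square at `x`. -/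
theorem link_ring (x : Site d L) (a : Fin 4) :
    link (ring hmk hml x a) 0 = (eStart k l x a, m) ∧
      link (ring hmk hml x a) 1 = link (sq k l hkl (x.shift m)) a ∧
      link (ring hmk hml x a) 2 = (eEnd k l x a, m) ∧
      link (ring hmk hml x a) 3 = link (sq k l hkl x) a := by
  refine ⟨rfl, ?_, rfl, ?_⟩
  · rw [link_sq, eStart_shift]; rfl
  · rw [link_sq]; rfl

/-- Membership of a link in a ring face. -/
theorem hasLink_ring_iff (x : Site d L) (a : Fin 4) (e : Edge d L) :
    HasLink (ring hmk hml x a) e ↔ e = (eStart k l x a, m) ∨ e = link (sq k l hkl (x.shift m)) a ∨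
      e = (eEnd k l x a, m) ∨ e = link (sq k l hkl x) a := by
  obtain ⟨h0, h1, h2, h3⟩ := link_ring hmk hml hkl x a
  unfold HasLink
  constructor
  · rintro ⟨b, rfl⟩
    fin_cases b
    · exact Or.inl h0
    · exact Or.inr (Or.inl h1)
    · exact Or.inr (Or.inr (Or.inl h2))
    · exact Or.inr (Or.inr (Or.inr h3))
  · rintro (rfl | rfl | rfl | rfl)
    · exact ⟨0, h0⟩
    · exact ⟨1, h1⟩
    · exact ⟨2, h2⟩
    · exact ⟨3, h3⟩

/-- A ring face contains edge `a` of the lower square. -/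
theorem hasLink_ring_low (x : Site d L) (a : Fin 4) :
    HasLink (ring hmk hml x a) (link (sq k l hkl x) a) :=
  (hasLink_ring_iff hmk hml hkl x a _).2 (Or.inr (Or.inr (Or.inr rfl)))

/-- A ring face contains edge `a` of the upper square. -/
theorem hasLink_ring_high (x : Site d L) (a : Fin 4) :
    HasLink (ring hmk hml x a) (link (sq k l hkl (x.shift m)) a) :=
  (hasLink_ring_iff hmk hml hkl x a _).2 (Or.inr (Or.inl rfl))

/-- A ring face contains the longitudinal link at the start of edge `a`. -/
theorem hasLink_ring_start (x : Site d L) (a : Fin 4) :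
    HasLink (ring hmk hml x a) (eStart k l x a, m) :=
  (hasLink_ring_iff hmk hml hkl x a _).2 (Or.inl rfl)

/-- A ring face contains the longitudinal link at the end of edge `a`. -/
theorem hasLink_ring_end (x : Site d L) (a : Fin 4) :
    HasLink (ring hmk hml x a) (eEnd k l x a, m) :=
  (hasLink_ring_iff hmk hml hkl x a _).2 (Or.inr (Or.inr (Or.inl rfl)))

/-- **The transverse links of a ring face are edge `a` of the two squares**: a link in direction
`k` or `l` of `ring x a` is `link (sq x) a` or `link (sq (x+e_m)) a`. -/
theorem hasLink_ring_transverse {x : Site d L} {a : Fin 4} {s : Site d L} {n : Fin d}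
    (hn : n = k ∨ n = l) (h : HasLink (ring hmk hml x a) (s, n)) :
    (s, n) = link (sq k l hkl (x.shift m)) a ∨ (s, n) = link (sq k l hkl x) a := by
  have hnm : n ≠ m := by rcases hn with rfl | rfl <;> exact (ne_of_lt ‹_›).symm
  rcases (hasLink_ring_iff hmk hml hkl x a _).1 h with h' | h' | h' | h'
  · exact absurd (congrArg Prod.snd h') hnm
  · exact Or.inl h'
  · exact absurd (congrArg Prod.snd h') hnm
  · exact Or.inr h'

/-- **The longitudinal links of a ring face**: a link in direction `m` of `ring x a` is
`(eStart a, m)` or `(eEnd a, m)`. -/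
theorem hasLink_ring_longitudinal {x : Site d L} {a : Fin 4} {s : Site d L}
    (h : HasLink (ring hmk hml x a) (s, m)) : s = eStart k l x a ∨ s = eEnd k l x a := by
  rcases (hasLink_ring_iff hmk hml hkl x a _).1 h with h' | h' | h' | h'
  · exact Or.inl (congrArg Prod.fst h')
  · rw [link_sq] at h'
    exact absurd (congrArg Prod.snd h') (ne_of_lt (lt_eDir hmk hml a))
  · exact Or.inr (congrArg Prod.fst h')
  · rw [link_sq] at h'
    exact absurd (congrArg Prod.snd h') (ne_of_lt (lt_eDir hmk hml a))

/-- A ring face contains no link in a fourth direction. -/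
theorem not_hasLink_ring_of_dir {x : Site d L} {a : Fin 4} {s : Site d L} {n : Fin d}
    (hnm : n ≠ m) (hnk : n ≠ k) (hnl : n ≠ l) : ¬ HasLink (ring hmk hml x a) (s, n) := by
  intro h
  rcases (hasLink_ring_iff hmk hml hkl x a _).1 h with h' | h' | h' | h'
  · exact hnm (congrArg Prod.snd h')
  · rw [link_sq] at h'
    rcases eDir_eq_or (k := k) (l := l) a with h'' | h''
    · exact hnk ((congrArg Prod.snd h').trans h'')
    · exact hnl ((congrArg Prod.snd h').trans h'')
  · exact hnm (congrArg Prod.snd h')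
  · rw [link_sq] at h'
    rcases eDir_eq_or (k := k) (l := l) a with h'' | h''
    · exact hnk ((congrArg Prod.snd h').trans h'')
    · exact hnl ((congrArg Prod.snd h').trans h'')

/-- **Which ring faces contain a given edge of the lower square**: only the face of that edge
(`L ≥ 3`). -/
theorem eq_of_hasLink_ring_low (hL : 3 ≤ L) {x : Site d L} {a b : Fin 4}
    (h : HasLink (ring hmk hml x b) (link (sq k l hkl x) a)) : b = a := by
  rw [link_sq] at h
  rcases hasLink_ring_transverse hmk hml hkl (eDir_eq_or a) h with h' | h'
  · -- a link of the square at `x` is not a link of the square at `x + e_m`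
    exfalso
    rw [← link_sq hkl] at h'
    have h1 := congrArg Prod.fst h'
    rw [link_sq, link_sq, eStart_shift] at h1
    simp only at h1
    -- eStart x a = eStart x b + e_m: compare the `m`-coordinates
    have h2 := congrFun h1 m
    have hmk' : m ≠ k := ne_of_lt hmk
    have hml' : m ≠ l := ne_of_lt hml
    fin_cases a <;> fin_cases b <;>
      simp [eStart, Site.shift, Pi.single_eq_of_ne hmk', Pi.single_eq_of_ne hml',
        one_ne_zero_of_three_le hL] at h2
  · rw [← link_sq hkl] at h'
    exact ((link_sq_injective hkl hL x) h').symm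

/-- **Which ring faces contain a given edge of the upper square**: only the face of that edge. -/
theorem eq_of_hasLink_ring_high (hL : 3 ≤ L) {x : Site d L} {a b : Fin 4}
    (h : HasLink (ring hmk hml x b) (link (sq k l hkl (x.shift m)) a)) : b = a := by
  rw [link_sq] at h
  rcases hasLink_ring_transverse hmk hml hkl (eDir_eq_or a) h with h' | h'
  · rw [← link_sq hkl] at h'
    exact ((link_sq_injective hkl hL _) h').symm
  · exfalso
    rw [← link_sq hkl] at h'
    have h1 := congrArg Prod.fst h'
    rw [link_sq, link_sq, eStart_shift] at h1
    simp only at h1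
    have h2 := congrFun h1 m
    have hmk' : m ≠ k := ne_of_lt hmk
    have hml' : m ≠ l := ne_of_lt hml
    fin_cases a <;> fin_cases b <;>
      simp [eStart, Site.shift, Pi.single_eq_of_ne hmk', Pi.single_eq_of_ne hml',
        one_ne_zero_of_three_le hL] at h2

/-- Ring faces of distinct edges are distinct. -/
theorem ring_injective (hL : 3 ≤ L) (x : Site d L) : Function.Injective (ring (L := L) hmk hml x) :=
  fun a b h => (eq_of_hasLink_ring_low hmk hml hkl hL (x := x) (a := a) (b := b)
    (by rw [← h]; exact hasLink_ring_low hmk hml hkl x a)).symm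

end Ring

end DiagRPTube

end Summit.QuantumFields.GaugeBoot
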